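import Literature.MathematicalPhysics.QuantumLattice.HubbardFermiRadiusBand
import HarnessLib

/-!
# The band Fermi radius: joint continuity in the level and the angle, and the `D₄` symmetries

Topic `Literature/MathematicalPhysics/QuantumLattice`; continues `HubbardFermiRadiusBand.lean`
(`u_μ(θ) = bandFermiRadius μ θ`, the polar radius of the Fermi curve `{ε = μ}` of
`ε(k) = -2(cos k₁ + cos k₂)` for `-4 < μ < 0`):

* `continuousOn_bandFermiRadius` — **`(μ, θ) ↦ u_μ(θ)` is continuous on `(-4, 0) × ℝ`** (the root
  of a jointly continuous, radially strictly increasing function); `continuous_bandFermiRadius`;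
* `bandFermiRadius_add_pi`, `bandFermiRadius_neg`, `bandFermiRadius_pi_div_two_sub` — inversion,
  reflection and exchange symmetry (the `D₄` invariance of the curve), `bandFermiRadius_add_two_pi`;
* `norm_fermiPolarVelocity_sq` (`‖γ'‖² = u'² + u²`), `fermiPolarVelocity_ne_zero`,
  `sin_sq_add_sin_sq_fermiPolar_pos` (`∇ε ≠ 0` on the curve), `fermiPolarDOS_pos`.

Everything is proved; no definitions. [folklore]

## Sources

Folklore; cf. Benfatto–Giuliani–Mastropietro, Ann. Henri Poincaré 7 (2006), §1 (1.4)–(1.5)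
(`BenfattoGiulianiMastropietro2006`) for the polar description at small filling.
-/

noncomputable section

open Real Set Filter
open scoped Topology

namespace Literature.MathematicalPhysics.QuantumLattice

/-! ### Joint continuity in the level and the angle -/

/-- **`(μ, θ) ↦ u_μ(θ)` is continuous on `(-4, 0) × ℝ`** (the root of a jointly continuous,
radially strictly increasing function). [folklore] -/
theorem continuousOn_bandFermiRadius :
    ContinuousOn (fun p : ℝ × ℝ => bandFermiRadius p.1 p.2) (Ioo (-4 : ℝ) 0 ×ˢ univ) := by
  rw [Metric.continuousOn_iff]
  rintro ⟨μ, θ⟩ ⟨⟨hμ₁, hμ₂⟩, -⟩ ε hε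
  set t₀ := bandFermiRadius μ θ with ht₀
  have ht₀pos : 0 < t₀ := bandFermiRadius_pos hμ₁ hμ₂ θ
  have ht₀lt : t₀ < π / ‖dir θ‖ := bandFermiRadius_lt_exit hμ₁ hμ₂ θ
  -- a margin `ε' < ε` keeping `t₀ ± ε'` inside `(0, π/‖dir θ‖)`
  set ε' := min ε (min t₀ (π / ‖dir θ‖ - t₀)) / 2 with hε'
  have hmpos : 0 < min ε (min t₀ (π / ‖dir θ‖ - t₀)) := lt_min hε (lt_min ht₀pos (by linarith))
  have hε'pos : 0 < ε' := by positivity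
  have hε'le : ε' < ε := by
    have : min ε (min t₀ (π / ‖dir θ‖ - t₀)) ≤ ε := min_le_left _ _
    linarith
  have hlo : 0 < t₀ - ε' := by
    have : min ε (min t₀ (π / ‖dir θ‖ - t₀)) ≤ t₀ := (min_le_right _ _).trans (min_le_left _ _)
    linarith
  have hhi : t₀ + ε' < π / ‖dir θ‖ := by
    have : min ε (min t₀ (π / ‖dir θ‖ - t₀)) ≤ π / ‖dir θ‖ - t₀ :=
      (min_le_right _ _).trans (min_le_right _ _)
    linarith
  have hmono := strictMonoOn_rayDispersion_band θ
  have hmemlo : t₀ - ε' ∈ Icc 0 (π / ‖dir θ‖) := ⟨hlo.le, by linarith⟩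
  have hmemhi : t₀ + ε' ∈ Icc 0 (π / ‖dir θ‖) := ⟨by linarith, hhi.le⟩
  have hmem0 : t₀ ∈ Icc 0 (π / ‖dir θ‖) := ⟨ht₀pos.le, ht₀lt.le⟩
  have hbelow : rayDispersion (θ, t₀ - ε') < μ := by
    have h := hmono hmemlo hmem0 (by linarith)
    simp only at h
    rwa [rayDispersion_bandFermiRadius hμ₁ hμ₂ θ] at h
  have habove : μ < rayDispersion (θ, t₀ + ε') := by
    have h := hmono hmem0 hmemhi (by linarith)
    simp only at h
    rwa [rayDispersion_bandFermiRadius hμ₁ hμ₂ θ] at h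
  -- the three strict inequalities persist for nearby `(μ', θ')`
  have hc : ∀ t : ℝ, Continuous fun p : ℝ × ℝ => rayDispersion (p.2, t) - p.1 := fun t =>
    ((contDiff_rayDispersion (n := 1)).continuous.comp
      (continuous_snd.prodMk continuous_const)).sub continuous_fst
  have hT : Continuous fun p : ℝ × ℝ => π / ‖dir p.2‖ :=
    continuous_const.div (continuous_norm_dir.comp continuous_snd) fun p => (norm_dir_pos p.2).ne'
  have hbelow' : (fun p : ℝ × ℝ => rayDispersion (p.2, t₀ - ε') - p.1) (μ, θ) < 0 := by
    simp only; linarith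
  have habove' : 0 < (fun p : ℝ × ℝ => rayDispersion (p.2, t₀ + ε') - p.1) (μ, θ) := by
    simp only; linarith
  have hhi' : t₀ + ε' < (fun p : ℝ × ℝ => π / ‖dir p.2‖) (μ, θ) := by simpa using hhi
  have hev1 : ∀ᶠ p : ℝ × ℝ in 𝓝 (μ, θ), rayDispersion (p.2, t₀ - ε') - p.1 < 0 :=
    (hc (t₀ - ε')).continuousAt.eventually (gt_mem_nhds hbelow')
  have hev2 : ∀ᶠ p : ℝ × ℝ in 𝓝 (μ, θ), 0 < rayDispersion (p.2, t₀ + ε') - p.1 :=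
    (hc (t₀ + ε')).continuousAt.eventually (lt_mem_nhds habove')
  have hev3 : ∀ᶠ p : ℝ × ℝ in 𝓝 (μ, θ), t₀ + ε' < π / ‖dir p.2‖ :=
    hT.continuousAt.eventually (lt_mem_nhds hhi')
  have hev4 : ∀ᶠ p : ℝ × ℝ in 𝓝 (μ, θ), p.1 ∈ Ioo (-4 : ℝ) 0 :=
    continuous_fst.continuousAt.eventually (isOpen_Ioo.mem_nhds ⟨hμ₁, hμ₂⟩)
  have hev : ∀ᶠ p : ℝ × ℝ in 𝓝 (μ, θ), (rayDispersion (p.2, t₀ - ε') - p.1 < 0 ∧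
      0 < rayDispersion (p.2, t₀ + ε') - p.1) ∧ (t₀ + ε' < π / ‖dir p.2‖ ∧ p.1 ∈ Ioo (-4 : ℝ) 0) :=
    (hev1.and hev2).and (hev3.and hev4)
  obtain ⟨δ, hδ, hball⟩ := Metric.eventually_nhds_iff.1 hev
  refine ⟨δ, hδ, fun p _ hp => ?_⟩
  obtain ⟨⟨h1, h2⟩, h3, hμ'⟩ := hball hp
  -- the root at `p = (μ', θ')` is squeezed between `t₀ - ε'` and `t₀ + ε'`
  have hu' := isBandFermiRadius_bandFermiRadius hμ'.1 hμ'.2 p.2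
  have hmono' := strictMonoOn_rayDispersion_band p.2
  have hmemlo' : t₀ - ε' ∈ Icc 0 (π / ‖dir p.2‖) := ⟨hlo.le, by linarith⟩
  have hmemhi' : t₀ + ε' ∈ Icc 0 (π / ‖dir p.2‖) := ⟨by linarith, h3.le⟩
  have hgt : t₀ - ε' < bandFermiRadius p.1 p.2 := by
    by_contra h
    have h : bandFermiRadius p.1 p.2 ≤ t₀ - ε' := le_of_not_gt h
    have := hmono'.monotoneOn hu'.mem_Icc hmemlo' h
    rw [hu'.2] at this
    linarith
  have hlt' : bandFermiRadius p.1 p.2 < t₀ + ε' := by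
    by_contra h
    have h : t₀ + ε' ≤ bandFermiRadius p.1 p.2 := le_of_not_gt h
    have := hmono'.monotoneOn hmemhi' hu'.mem_Icc h
    rw [hu'.2] at this
    linarith
  rw [Real.dist_eq, abs_lt]
  constructor <;> linarith

/-- Continuity in the angle at fixed level. [folklore] -/
theorem continuous_bandFermiRadius {μ : ℝ} (hμ₁ : -4 < μ) (hμ₂ : μ < 0) :
    Continuous (bandFermiRadius μ) := by
  have h := continuousOn_bandFermiRadius.comp_continuous (continuous_const.prodMk continuous_id)
    fun θ => ⟨⟨hμ₁, hμ₂⟩, mem_univ θ⟩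
  exact h

/-! ### Symmetries -/

section Symm

variable {μ : ℝ} (hμ₁ : -4 < μ) (hμ₂ : μ < 0)
include hμ₁ hμ₂

/-- A direction with the same ray dispersion and the same sup norm has the same band Fermi radius.
[folklore] -/
theorem bandFermiRadius_eq_of_forall_eq {θ θ' : ℝ}
    (h : ∀ t : ℝ, rayDispersion (θ', t) = rayDispersion (θ, t)) (hn : ‖dir θ'‖ = ‖dir θ‖) :
    bandFermiRadius μ θ' = bandFermiRadius μ θ := by
  have hu := isBandFermiRadius_bandFermiRadius hμ₁ hμ₂ θ'
  refine bandFermiRadius_unique hμ₁ hμ₂ ⟨⟨hu.1.1, ?_⟩, ?_⟩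
  · rw [← hn]; exact hu.1.2
  · rw [← h, hu.2]

/-- **Inversion symmetry**: `u_μ(θ + π) = u_μ(θ)`. [folklore] -/
theorem bandFermiRadius_add_pi (θ : ℝ) : bandFermiRadius μ (θ + π) = bandFermiRadius μ θ :=
  bandFermiRadius_eq_of_forall_eq hμ₁ hμ₂
    (fun t => by simp [rayDispersion_eq, Real.cos_add_pi, Real.sin_add_pi, Real.cos_neg])
    (by rw [norm_dir, norm_dir]; simp [Real.cos_add_pi, Real.sin_add_pi])

/-- **Reflection symmetry**: `u_μ(-θ) = u_μ(θ)`. [folklore] -/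
theorem bandFermiRadius_neg (θ : ℝ) : bandFermiRadius μ (-θ) = bandFermiRadius μ θ :=
  bandFermiRadius_eq_of_forall_eq hμ₁ hμ₂
    (fun t => by simp [rayDispersion_eq, Real.cos_neg, Real.sin_neg])
    (by rw [norm_dir, norm_dir]; simp [Real.cos_neg, Real.sin_neg])

/-- **Exchange symmetry**: `u_μ(π/2 - θ) = u_μ(θ)`. [folklore] -/
theorem bandFermiRadius_pi_div_two_sub (θ : ℝ) :
    bandFermiRadius μ (π / 2 - θ) = bandFermiRadius μ θ :=
  bandFermiRadius_eq_of_forall_eq hμ₁ hμ₂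
    (fun t => by simp [rayDispersion_eq, Real.cos_pi_div_two_sub, Real.sin_pi_div_two_sub, add_comm])
    (by rw [norm_dir, norm_dir]; simp [Real.cos_pi_div_two_sub, Real.sin_pi_div_two_sub, max_comm])

end Symm


section Symm2

variable {μ : ℝ} (hμ₁ : -4 < μ) (hμ₂ : μ < 0)
include hμ₁ hμ₂

/-- **Periodicity**: `u_μ(θ + 2π) = u_μ(θ)`. [folklore] -/
theorem bandFermiRadius_add_two_pi (θ : ℝ) : bandFermiRadius μ (θ + 2 * π) = bandFermiRadius μ θ :=
  bandFermiRadius_eq_of_forall_eq hμ₁ hμ₂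
    (fun t => by simp [rayDispersion_eq, Real.cos_add_two_pi, Real.sin_add_two_pi])
    (by rw [norm_dir, norm_dir]; simp [Real.cos_add_two_pi, Real.sin_add_two_pi])

/-- Periodicity under integer multiples of `2π`. [folklore] -/
theorem bandFermiRadius_add_int_mul_two_pi (θ : ℝ) (k : ℤ) :
    bandFermiRadius μ (θ + k * (2 * π)) = bandFermiRadius μ θ :=
  bandFermiRadius_eq_of_forall_eq hμ₁ hμ₂
    (fun t => by simp [rayDispersion_eq, Real.cos_add_int_mul_two_pi, Real.sin_add_int_mul_two_pi])
    (by rw [norm_dir, norm_dir]; simp [Real.cos_add_int_mul_two_pi, Real.sin_add_int_mul_two_pi])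

/-- **Quarter-turn symmetry**: `u_μ(θ + π/2) = u_μ(θ)` (`ε(-k₂, k₁) = ε(k)`). [folklore] -/
theorem bandFermiRadius_add_pi_div_two (θ : ℝ) :
    bandFermiRadius μ (θ + π / 2) = bandFermiRadius μ θ :=
  bandFermiRadius_eq_of_forall_eq hμ₁ hμ₂
    (fun t => by simp [rayDispersion_eq, Real.cos_add_pi_div_two, Real.sin_add_pi_div_two, add_comm])
    (by rw [norm_dir, norm_dir]; simp [Real.cos_add_pi_div_two, Real.sin_add_pi_div_two, max_comm])

end Symm2

/-! ### Velocity and density of states: positivity -/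

/-- The squared speed: `‖γ'(θ)‖² = u'² + u²`. [folklore] -/
theorem norm_fermiPolarVelocity_sq (μ θ : ℝ) :
    ‖fermiPolarVelocity μ θ‖ ^ 2 = bandFermiRadiusDeriv μ θ ^ 2 + bandFermiRadius μ θ ^ 2 := by
  rw [fermiPolarVelocity, EuclideanSpace.norm_eq, Real.sq_sqrt (Finset.sum_nonneg fun i _ => by positivity),
    Fin.sum_univ_two]
  simp [dir, Real.norm_eq_abs, sq_abs]
  have := Real.cos_sq_add_sin_sq θ
  nlinarith [this]

section PolarBand2

variable {μ : ℝ} (hμ₁ : -4 < μ) (hμ₂ : μ < 0)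
include hμ₁ hμ₂

/-- The speed is at least the radius: `u ≤ ‖γ'‖`, in particular it is positive. [folklore] -/
theorem bandFermiRadius_le_norm_fermiPolarVelocity (θ : ℝ) :
    bandFermiRadius μ θ ≤ ‖fermiPolarVelocity μ θ‖ := by
  have h := norm_fermiPolarVelocity_sq μ θ
  have hR := bandFermiRadius_pos hμ₁ hμ₂ θ
  nlinarith [norm_nonneg (fermiPolarVelocity μ θ), sq_nonneg (bandFermiRadiusDeriv μ θ)]

/-- The velocity never vanishes. [folklore] -/
theorem norm_fermiPolarVelocity_pos (θ : ℝ) : 0 < ‖fermiPolarVelocity μ θ‖ :=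
  (bandFermiRadius_pos hμ₁ hμ₂ θ).trans_le (bandFermiRadius_le_norm_fermiPolarVelocity hμ₁ hμ₂ θ)

/-- The velocity never vanishes. [folklore] -/
theorem fermiPolarVelocity_ne_zero (θ : ℝ) : fermiPolarVelocity μ θ ≠ 0 :=
  norm_pos_iff.1 (norm_fermiPolarVelocity_pos hμ₁ hμ₂ θ)

/-- On the Fermi curve `∇ε ≠ 0`: `sin² k₀ + sin² k₁ > 0` at every polar point (a point of the open
square with both sines zero is the origin, where `ε = -4 ≠ μ`). [folklore] -/
theorem sin_sq_add_sin_sq_fermiPolar_pos (θ : ℝ) :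
    0 < Real.sin (fermiPolar μ θ 0) ^ 2 + Real.sin (fermiPolar μ θ 1) ^ 2 := by
  by_contra h
  have h0 : Real.sin (fermiPolar μ θ 0) ^ 2 + Real.sin (fermiPolar μ θ 1) ^ 2 = 0 :=
    le_antisymm (le_of_not_gt h) (by positivity)
  have hs0 : Real.sin (fermiPolar μ θ 0) = 0 := by nlinarith [sq_nonneg (Real.sin (fermiPolar μ θ 0)), sq_nonneg (Real.sin (fermiPolar μ θ 1))]
  have hs1 : Real.sin (fermiPolar μ θ 1) = 0 := by nlinarith [sq_nonneg (Real.sin (fermiPolar μ θ 0)), sq_nonneg (Real.sin (fermiPolar μ θ 1))]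
  -- a coordinate in `(-π, π)` with vanishing sine is `0`
  have hzero : ∀ i, Real.sin (fermiPolar μ θ i) = 0 → fermiPolar μ θ i = 0 := fun i hsin => by
    have hlt := abs_fermiPolar_apply_lt hμ₁ hμ₂ θ i
    rw [abs_lt] at hlt
    obtain ⟨n, hn⟩ := Real.sin_eq_zero_iff.1 hsin
    have hn1 : (n : ℝ) * π < π := hn ▸ hlt.2
    have hn2 : -π < (n : ℝ) * π := hn ▸ hlt.1
    have hlt1 : (n : ℝ) < 1 := by nlinarith [Real.pi_pos]
    have hgt1 : (-1 : ℝ) < n := by nlinarith [Real.pi_pos]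
    have : n = 0 := by
      have h1 : n < 1 := by exact_mod_cast hlt1
      have h2 : -1 < n := by exact_mod_cast hgt1
      omega
    rw [← hn, this]; simp
  have hx := hzero 0 hs0
  have hy := hzero 1 hs1
  have he := sqDispersion_ofLp_fermiPolar hμ₁ hμ₂ θ
  have : sqDispersion (WithLp.ofLp (fermiPolar μ θ)) = -4 := by
    have hx' : WithLp.ofLp (fermiPolar μ θ) 0 = 0 := hx
    have hy' : WithLp.ofLp (fermiPolar μ θ) 1 = 0 := hy
    simp [sqDispersion, hx', hy']; norm_num
  linarith

/-- **The density of states is positive.** [folklore] -/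
theorem fermiPolarDOS_pos (θ : ℝ) : 0 < fermiPolarDOS μ θ :=
  div_pos (norm_fermiPolarVelocity_pos hμ₁ hμ₂ θ)
    (mul_pos two_pos (Real.sqrt_pos.2 (sin_sq_add_sin_sq_fermiPolar_pos hμ₁ hμ₂ θ)))

end PolarBand2

end Literature.MathematicalPhysics.QuantumLattice

end
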